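import Literature.Computability.MetaComplexity.UPSearchScheme
import Literature.Computability.MetaComplexity.UPSearchBricks
import Literature.Computability.MetaComplexity.LanguageCompression
import Literature.Computability.MetaComplexity.GapMINKTSearchProofs
import Literature.Computability.Cryptography.LiuPassLemma53Programs
import Literature.Computability.Complexity.LengthCompare
import Literature.Computability.Complexity.StringEquality
import HarnessLib

/-!
# Complexity meta: the language ensemble `L'` of the proof of Thm. 8.9 is in `NP` (Hirahara 2021)

Topic `Literature/Computability/MetaComplexity`, machine companion of `UPSearchScheme.lean`. In the
proof of Thm. 8.9 of S. Hirahara, *Average-case hardness of NP from exponential worst-case hardness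
assumptions* (STOC 2021; ECCC TR21-058, p. 40), the ensemble `L' = {L'_{⟨n,k,t,s⟩}}` of `DP_k`-encoded
certificates is introduced with the words "It is easy to see that `L' ∈ NP`." This file proves it
for the `UP` version `UniversalMachine.upSlice` of the slices (and that `L'` is an ensemble of
languages in the sense of Def. 4.1), so that Thm. 4.2 (`Hirahara2021_languageCompression`) applies:

* `UniversalMachine.upLang U R p` — the language `L' = {(v, 1^ι) | v ∈ L'_ι}` with `ι = ⟨n,k,t,s⟩`
  (`idx4`), and `languageSlice_upLang : L'_ι = upSlice (unidx4 ι)`;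
* `isLanguageEnsemble_upLang` — `|v| ≤ poly(ι)` on `L'_ι` (Def. 4.1);
* `upLang_mem_NP` — **`L' ∈ NP`** for `R ∈ P`: the certificate is `⟨1ⁿ, 1ᵏ, 1ᵗ, 1ˢ, y, z, prog⟩`
  (the parameters, the certificate `y` of `x`, the seed `z`, and a program `prog` of length `≤ s`
  printing `x` within `t` steps, witnessing `K^t(x) ≤ s`); the verifier (an `FP` one-bit function,
  `verF`) re-encodes and compares (`eqPairFn`), recomputes `⟨n,k,t,s⟩` (`idx4UF`), the padding
  (`padCertUF`) and `DP_k` (the tree's Goldreich–Levin brick `L53Prog.glFn`), and runs the universal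
  machine (`GapMINKTDecision.runU`);
* the `rfl` bridges `hadBit_eq_ipBit`, `dpGen_eq_append_glBits` between `DirectProductGenerator.lean`
  and `Cryptography/GoldreichLevinHiding.lean` (requested when the former landed).

## References

* S. Hirahara, ECCC TR21-058, proof of Thm. 8.9 (p. 40: definition of `L'`, "`L' ∈ NP`"), Def. 4.1.
* S. Arora, B. Barak, *Computational Complexity*, CUP 2009, Def. 2.1 (certificates), §1.3.
-/

namespace Literature.Computability.MetaComplexity

open _root_.Computability Complexity Complexity.Classes Complexity.Nondeterministic Brick Plumb HashBricks
  Polynomial Cryptography GapMINKTDecision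

/-! ### Bridges to the Goldreich–Levin vocabulary of the `Cryptography` topic -/

/-- The Hadamard code of `DirectProductGenerator.lean` is the Goldreich–Levin predicate `ipBit`
(same body). [Hirahara 2021 (ECCC TR21-058), Def. 3.9; Goldreich–Levin 1989] [folklore] -/
theorem hadBit_eq_ipBit (x z : List Bool) : hadBit x z = ipBit x z := rfl

/-- `DP_k(x; z) = z ‖ glBits k |x| x z` (same body). [Hirahara 2021 (ECCC TR21-058), Def. 3.10]
[folklore] -/
theorem dpGen_eq_append_glBits (k : ℕ) (x z : List Bool) : dpGen k x z = z ++ glBits k x.length x z := rfl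

/-! ### The language `L'` and its slices -/

/-- Decoding the index `ι ↦ (n, k, t, s)` (nested `Nat.unpair`). [folklore] -/
def unidx4 (ι : ℕ) : ℕ × ℕ × ℕ × ℕ :=
  (ι.unpair.1, ι.unpair.2.unpair.1, ι.unpair.2.unpair.2.unpair.1, ι.unpair.2.unpair.2.unpair.2)

/-- `unidx4` inverts `idx4`. [folklore] -/
@[simp] theorem unidx4_idx4 (n k t s : ℕ) : unidx4 (idx4 n k t s) = (n, k, t, s) := by
  simp [unidx4, idx4]

/-- `idx4` inverts `unidx4`. [folklore] -/
theorem idx4_unidx4 (ι : ℕ) : idx4 (unidx4 ι).1 (unidx4 ι).2.1 (unidx4 ι).2.2.1 (unidx4 ι).2.2.2 = ι := by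
  simp [unidx4, idx4]

/-- The components are bounded by the index. [folklore] -/
theorem unidx4_le (ι : ℕ) :
    (unidx4 ι).1 ≤ ι ∧ (unidx4 ι).2.1 ≤ ι ∧ (unidx4 ι).2.2.1 ≤ ι ∧ (unidx4 ι).2.2.2 ≤ ι := by
  have h1 : ι.unpair.2 ≤ ι := Nat.unpair_right_le ι
  have h2 : ι.unpair.2.unpair.2 ≤ ι.unpair.2 := Nat.unpair_right_le _
  have h3 : ι.unpair.2.unpair.2.unpair.2 ≤ ι.unpair.2.unpair.2 := Nat.unpair_right_le _
  refine ⟨Nat.unpair_left_le ι, (Nat.unpair_left_le _).trans h1, (Nat.unpair_left_le _).trans (h2.trans h1),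
    h3.trans (h2.trans h1)⟩

namespace UniversalMachine

variable (U : UniversalMachine)

/-- **The language `L'` of the proof of Thm. 8.9 (for `UP`)**: the pairs `(v, 1^ι)` with `v` in the
slice `L'_{⟨n,k,t,s⟩} = upSlice` and `ι = ⟨n,k,t,s⟩`. [Hirahara 2021 (ECCC TR21-058), proof of Thm. 8.9
(p. 40)] [cite: Hirahara2021, Thm. 8.9 (proof)] -/
def upLang (R : Language Bool) (p : Polynomial ℕ) : Language Bool :=
  {w | ∃ (n k t s : ℕ) (v : List Bool), w = paramEnc (v, idx4 n k t s) ∧ v ∈ U.upSlice R p n k t s}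

variable {U}

/-- **The slices of `L'`** are the sets `upSlice` (every index decodes). [Hirahara 2021 (ECCC
TR21-058), proof of Thm. 8.9] [cite: Hirahara2021, Thm. 8.9 (proof)] -/
theorem languageSlice_upLang (R : Language Bool) (p : Polynomial ℕ) (ι : ℕ) :
    languageSlice (U.upLang R p) ι =
      U.upSlice R p (unidx4 ι).1 (unidx4 ι).2.1 (unidx4 ι).2.2.1 (unidx4 ι).2.2.2 := by
  ext v
  simp only [mem_languageSlice_iff, upLang]
  constructor
  · rintro ⟨n, k, t, s, v', h, hv⟩
    have h1 := boolPair_injective (a₁ := (v, _)) (a₂ := (v', _)) h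
    simp only [Prod.mk.injEq] at h1
    obtain ⟨rfl, h2⟩ := h1
    have hι : ι = idx4 n k t s := by simpa using congr_arg unaryDecodeNat h2
    subst hι
    simpa using hv
  · intro hv
    exact ⟨_, _, _, _, v, by rw [idx4_unidx4], hv⟩

/-- The slice at a coded index. [folklore] -/
theorem languageSlice_upLang_idx4 (R : Language Bool) (p : Polynomial ℕ) (n k t s : ℕ) :
    languageSlice (U.upLang R p) (idx4 n k t s) = U.upSlice R p n k t s := by
  rw [languageSlice_upLang, unidx4_idx4]

/-- **`L'` is an ensemble of languages** (Def. 4.1): members of `L'_ι` have length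
`n + (p(n)+1)k + k ≤ ι + (p(ι)+1)ι + ι`. [Hirahara 2021 (ECCC TR21-058), Def. 4.1, proof of Thm. 8.9]
[cite: Hirahara2021, Def. 4.1] -/
theorem isLanguageEnsemble_upLang (R : Language Bool) (p : Polynomial ℕ) : IsLanguageEnsemble (U.upLang R p) := by
  refine ⟨X + (p + 1) * X + X, fun ι v hv => ?_⟩
  rw [languageSlice_upLang] at hv
  obtain ⟨x, y, z, rfl, hx, -, hy, hz⟩ := hv
  obtain ⟨hn, hk, -, -⟩ := unidx4_le ι
  set n := (unidx4 ι).1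
  set k := (unidx4 ι).2.1
  simp only [List.length_append, length_dpGen, hx, hz, eval_add, eval_mul, eval_X, eval_one]
  have hp : p.eval n ≤ p.eval ι := polynomial_eval_mono p hn
  have : (p.eval n + 1) * k ≤ (p.eval ι + 1) * ι := Nat.mul_le_mul (by omega) hk
  omega

end UniversalMachine

/-! ### The certificate and the verifier -/

/-- The certificate `⟨1ⁿ, ⟨1ᵏ, ⟨1ᵗ, ⟨1ˢ, ⟨y, ⟨z, prog⟩⟩⟩⟩⟩⟩`. [Hirahara 2021 (ECCC TR21-058), proof of
Thm. 8.9 ("`L' ∈ NP`")] [folklore] -/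
def upCert (n k t s : ℕ) (y z prog : List Bool) : List Bool :=
  boolPair (ones n) (boolPair (ones k) (boolPair (ones t) (boolPair (ones s) (boolPair y (boolPair z prog)))))

namespace UPNP

/-- `v'` (the slice member) from `⟨⟨v', 1^ι⟩, cert⟩`. [folklore] -/
noncomputable def wF : List Bool → List Bool := fstF ∘ fstF
/-- `1^ι`, normalised. [folklore] -/
noncomputable def uiF : List Bool → List Bool := onesFn ∘ sndF ∘ fstF
/-- `1ⁿ`, normalised. [folklore] -/
noncomputable def unF : List Bool → List Bool := onesFn ∘ nthF 0 ∘ sndF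
/-- `1ᵏ`, normalised. [folklore] -/
noncomputable def ukF : List Bool → List Bool := onesFn ∘ nthF 1 ∘ sndF
/-- `1ᵗ`, normalised. [folklore] -/
noncomputable def utF : List Bool → List Bool := onesFn ∘ nthF 2 ∘ sndF
/-- `1ˢ`, normalised. [folklore] -/
noncomputable def usF : List Bool → List Bool := onesFn ∘ nthF 3 ∘ sndF
/-- `y`. [folklore] -/
noncomputable def yF : List Bool → List Bool := nthF 4 ∘ sndF
/-- `z`. [folklore] -/
noncomputable def zF : List Bool → List Bool := nthF 5 ∘ sndF
/-- `prog`. [folklore] -/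
noncomputable def progF : List Bool → List Bool := sndPow 5 ∘ sndF
/-- `x := v' ↾ n`. [folklore] -/
noncomputable def xF : List Bool → List Bool := takeFn ∘ fanoutFn unF wF

variable (p : Polynomial ℕ)

/-- `ỹ := padCert p(n) y`. [folklore] -/
noncomputable def padF : List Bool → List Bool := padCertUF ∘ fanoutFn (polyFn p ∘ unF) yF
/-- `x ‖ DP_k(ỹ; z) = x ‖ z ‖ glBits k |ỹ| ỹ z`. [folklore] -/
noncomputable def rhsF : List Bool → List Bool :=
  fun π => xF π ++ (fun π => zF π ++ (L53Prog.glFn ∘ fanoutFn (fanoutFn ukF (onesFn ∘ padF p)) (fanoutFn (padF p) zF)) π) π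

variable (U : UniversalMachine) (rTest : List Bool → List Bool)

/-- **The verifier** of `L'`, as a one-bit string function on `⟨⟨v', 1^ι⟩, cert⟩`: the conjunction of
(0) the instance is well-formed, (1) `ι = ⟨n,k,t,s⟩`, (2) `n ≤ |v'|`, (3) `v' = x ‖ DP_k(ỹ; z)`,
(4) `|z| = (p(n)+1)k`, (5) `|y| ≤ p(|x|)`, (6) `⟨x, y⟩ ∈ R`, (7) `|prog| ≤ s`, (8) `U(prog, 1ᵗ) = x`.
[Hirahara 2021 (ECCC TR21-058), proof of Thm. 8.9 ("It is easy to see that `L' ∈ NP`")] [folklore] -/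
noncomputable def verF : List Bool → List Bool :=
  andFn (eqPairFn ∘ fanoutFn (fanoutFn wF uiF) fstF)
  (andFn (eqPairFn ∘ fanoutFn uiF (idx4UF ∘ fanoutFn unF (fanoutFn ukF (fanoutFn utF usF))))
  (andFn (lenLeFn X ∘ fanoutFn wF unF)
  (andFn (eqPairFn ∘ fanoutFn wF (rhsF p))
  (andFn (eqPairFn ∘ fanoutFn (onesFn ∘ zF) (umulFn ∘ fanoutFn (polyFn (p + 1) ∘ unF) ukF))
  (andFn (lenLeFn p ∘ fanoutFn xF yF)
  (andFn (rTest ∘ fanoutFn xF yF)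
  (andFn (lenLeFn X ∘ fanoutFn usF progF)
    (eqPairFn ∘ fanoutFn (runU U ∘ fanoutFn progF utF) (List.cons true ∘ xF)))))))))

variable {p U rTest}

/-- **Semantics of the verifier** on `⟨⟨v', 1^ι⟩, cert⟩` for an arbitrary certificate string, in
terms of its fields `n = |cert₀|, k = |cert₁|, t = |cert₂|, s = |cert₃|, y = cert₄, z = cert₅,
prog = cert₆₊`. [folklore] -/
theorem verF_apply {R : Language Bool} (hr : ∀ v, rTest v = [R.boolIndicator v]) (v' : List Bool) (ι : ℕ)
    (c : List Bool) :
    verF p U rTest (boolPair (paramEnc (v', ι)) c) = [true] ↔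
      (ι = idx4 (nthF 0 c).length (nthF 1 c).length (nthF 2 c).length (nthF 3 c).length ∧
       (nthF 0 c).length ≤ v'.length ∧
       v' = v'.take (nthF 0 c).length ++
         dpGen (nthF 1 c).length (padCert (p.eval (nthF 0 c).length) (nthF 4 c)) (nthF 5 c) ∧
       (nthF 5 c).length = (p.eval (nthF 0 c).length + 1) * (nthF 1 c).length ∧
       (nthF 4 c).length ≤ p.eval (v'.take (nthF 0 c).length).length ∧
       boolPair (v'.take (nthF 0 c).length) (nthF 4 c) ∈ R ∧
       (sndPow 5 c).length ≤ (nthF 3 c).length ∧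
       U.run (sndPow 5 c) (nthF 2 c).length = some (v'.take (nthF 0 c).length)) := by
  set n := (nthF 0 c).length
  set k := (nthF 1 c).length
  set t := (nthF 2 c).length
  set s := (nthF 3 c).length
  set y := nthF 4 c
  set z := nthF 5 c
  set prog := sndPow 5 c
  set π := boolPair (paramEnc (v', ι)) c with hπ
  set x := v'.take n with hx
  -- field values
  have hfst : fstF π = paramEnc (v', ι) := by simp [hπ]
  have hw : wF π = v' := by simp [wF, hπ, paramEnc]
  have hui : uiF π = ones ι := by
    simp [uiF, hπ, paramEnc, CondRed.onesFn_eq_ones, OracleCompose.unaryEncodeNat_eq_replicate]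
  have hun : unF π = ones n := by simp [unF, hπ, CondRed.onesFn_eq_ones, n]
  have huk : ukF π = ones k := by simp [ukF, hπ, CondRed.onesFn_eq_ones, k]
  have hut : utF π = ones t := by simp [utF, hπ, CondRed.onesFn_eq_ones, t]
  have hus : usF π = ones s := by simp [usF, hπ, CondRed.onesFn_eq_ones, s]
  have hy : yF π = y := by simp [yF, hπ, y]
  have hz : zF π = z := by simp [zF, hπ, z]
  have hprog : progF π = prog := by simp [progF, hπ, prog]
  have hlen : ∀ m, (ones m).length = m := fun m => by simp [ones]
  have hxF : xF π = x := by
    rw [xF, Function.comp_apply, fanoutFn_apply, hun, hw, takeFn_boolPair, hlen]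
  have hpad : padF p π = padCert (p.eval n) y := by
    rw [padF, Function.comp_apply, fanoutFn_apply, Function.comp_apply, hun, hy, polyFn_apply, hlen,
      padCertUF_boolPair]
    rfl
  have hrhs : rhsF p π = x ++ dpGen k (padCert (p.eval n) y) z := by
    simp only [rhsF, Function.comp_apply, fanoutFn_apply, hxF, hz, huk, hpad, CondRed.onesFn_eq_ones,
      L53Prog.glFn_boolPair, dpGen_eq_append_glBits]
  -- the nine conditions
  have c0 : (eqPairFn ∘ fanoutFn (fanoutFn wF uiF) fstF) π = [true] := by
    rw [Function.comp_apply, fanoutFn_apply, fanoutFn_apply, hw, hui, hfst, eqPairFn_boolPair, paramEnc,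
      ← CondRed.unaryEncodeNat_eq_ones, decide_eq_true rfl]
  have c1 : (eqPairFn ∘ fanoutFn uiF (idx4UF ∘ fanoutFn unF (fanoutFn ukF (fanoutFn utF usF)))) π =
      [decide (ι = idx4 n k t s)] := by
    rw [Function.comp_apply, fanoutFn_apply, Function.comp_apply, fanoutFn_apply, fanoutFn_apply, fanoutFn_apply,
      hui, hun, huk, hut, hus, idx4UF_apply, eqPairFn_boolPair, Bool.decide_congr List.replicate_left_inj]
    rfl
  have c2 : (lenLeFn X ∘ fanoutFn wF unF) π = [decide (n ≤ v'.length)] := by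
    rw [Function.comp_apply, fanoutFn_apply, hw, hun, lenLeFn_boolPair, eval_X, hlen]
  have c3 : (eqPairFn ∘ fanoutFn wF (rhsF p)) π = [decide (v' = x ++ dpGen k (padCert (p.eval n) y) z)] := by
    rw [Function.comp_apply, fanoutFn_apply, hw, hrhs, eqPairFn_boolPair]
  have c4 : (eqPairFn ∘ fanoutFn (onesFn ∘ zF) (umulFn ∘ fanoutFn (polyFn (p + 1) ∘ unF) ukF)) π =
      [decide (z.length = (p.eval n + 1) * k)] := by
    rw [Function.comp_apply, fanoutFn_apply, Function.comp_apply, Function.comp_apply, fanoutFn_apply,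
      Function.comp_apply, hz, hun, huk, polyFn_apply, hlen, CondRed.onesFn_eq_ones, umulFn_boolPair, eqPairFn_boolPair,
      Bool.decide_congr List.replicate_left_inj, eval_add, eval_one]
  have c5 : (lenLeFn p ∘ fanoutFn xF yF) π = [decide (y.length ≤ p.eval x.length)] := by
    rw [Function.comp_apply, fanoutFn_apply, hxF, hy, lenLeFn_boolPair]
  have c6 : (rTest ∘ fanoutFn xF yF) π = [R.boolIndicator (boolPair x y)] := by
    rw [Function.comp_apply, fanoutFn_apply, hxF, hy, hr]
  have c7 : (lenLeFn X ∘ fanoutFn usF progF) π = [decide (prog.length ≤ s)] := by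
    rw [Function.comp_apply, fanoutFn_apply, hus, hprog, lenLeFn_boolPair, eval_X, hlen]
  have c8 : (eqPairFn ∘ fanoutFn (runU U ∘ fanoutFn progF utF) (List.cons true ∘ xF)) π =
      [decide (U.run prog t = some x)] := by
    rw [Function.comp_apply, fanoutFn_apply, Function.comp_apply, fanoutFn_apply, Function.comp_apply,
      hprog, hut, hxF, runU_boolPair, hlen, eqPairFn_boolPair, Bool.decide_congr (encO_eq_cons_iff _ _)]
  unfold verF
  rw [andFn_apply c0 (andFn_apply c1 (andFn_apply c2 (andFn_apply c3 (andFn_apply c4 (andFn_apply c5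
    (andFn_apply c6 (andFn_apply c7 c8)))))))]
  simp only [List.cons.injEq, and_true, Bool.true_and, Bool.and_eq_true, decide_eq_true_eq]
  rw [← Set.mem_iff_boolIndicator]
  exact Iff.rfl

/-- **Soundness on arbitrary inputs**: if the verifier accepts `⟨v, c⟩` then `v` is a well-formed
instance `⟨v', 1^ι⟩` (condition (0) re-encodes and compares). [folklore] -/
theorem eq_paramEnc_of_verF (v c : List Bool) (h : verF p U rTest (boolPair v c) = [true]) :
    v = paramEnc (fstF v, (sndF v).length) := by
  have h0 : (eqPairFn ∘ fanoutFn (fanoutFn wF uiF) fstF) (boolPair v c) = [true] := by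
    unfold verF at h
    obtain ⟨b, hb⟩ : ∃ b, (eqPairFn ∘ fanoutFn (fanoutFn wF uiF) fstF) (boolPair v c) = [b] := by
      rcases eqPairFn_eq_or (fanoutFn (fanoutFn wF uiF) fstF (boolPair v c)) with h' | h' <;> exact ⟨_, h'⟩
    rw [andFn, iteFn_apply hb] at h
    cases b with
    | true => exact hb
    | false => simp at h
  rw [Function.comp_apply, fanoutFn_apply, fanoutFn_apply, fstF_boolPair, eqPairFn_boolPair] at h0
  simp only [wF, uiF, Function.comp_apply, fstF_boolPair, List.cons.injEq, and_true, decide_eq_true_eq] at h0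
  rw [onesFn] at h0
  exact h0.symm

/-- The verifier is one-bit. [folklore] -/
theorem oneBit_verF (hr : OneBit rTest) : OneBit (verF p U rTest) := by
  have he : ∀ f : List Bool → List Bool, OneBit (eqPairFn ∘ f) := fun f z => by
    rcases eqPairFn_eq_or (f z) with h | h <;> exact ⟨_, h⟩
  have hl : ∀ (q : Polynomial ℕ) (f : List Bool → List Bool), OneBit (lenLeFn q ∘ f) := fun q f z => by
    rcases lenLeFn_eq_or q (f z) with h | h <;> exact ⟨_, h⟩
  unfold verF
  exact oneBit_andFn (he _) (oneBit_andFn (he _) (oneBit_andFn (hl _ _) (oneBit_andFn (he _)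
    (oneBit_andFn (he _) (oneBit_andFn (hl _ _) (oneBit_andFn (hr.comp _) (oneBit_andFn (hl _ _) (he _))))))))

/-- **The verifier is polynomial-time** (`FP`) when the membership test of `R` is. [Hirahara 2021
(ECCC TR21-058), proof of Thm. 8.9 ("`L' ∈ NP`")] [folklore] -/
theorem verF_mem_FP (hr : rTest ∈ FP) : verF p U rTest ∈ FP := by
  have hw : wF ∈ FP := comp_mem_FP fstF_mem_FP fstF_mem_FP
  have hui : uiF ∈ FP := comp_mem_FP onesFn_mem_FP (comp_mem_FP sndF_mem_FP fstF_mem_FP)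
  have hun : unF ∈ FP := comp_mem_FP onesFn_mem_FP (comp_mem_FP (nthF_mem_FP 0) sndF_mem_FP)
  have huk : ukF ∈ FP := comp_mem_FP onesFn_mem_FP (comp_mem_FP (nthF_mem_FP 1) sndF_mem_FP)
  have hut : utF ∈ FP := comp_mem_FP onesFn_mem_FP (comp_mem_FP (nthF_mem_FP 2) sndF_mem_FP)
  have hus : usF ∈ FP := comp_mem_FP onesFn_mem_FP (comp_mem_FP (nthF_mem_FP 3) sndF_mem_FP)
  have hy : yF ∈ FP := comp_mem_FP (nthF_mem_FP 4) sndF_mem_FP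
  have hz : zF ∈ FP := comp_mem_FP (nthF_mem_FP 5) sndF_mem_FP
  have hprog : progF ∈ FP := comp_mem_FP (sndPow_mem_FP 5) sndF_mem_FP
  have hx : xF ∈ FP := comp_mem_FP takeFn_mem_FP (fanoutFn_mem_FP hun hw)
  have hpad : padF p ∈ FP := comp_mem_FP padCertUF_mem_FP (fanoutFn_mem_FP (comp_mem_FP (polyFn_mem_FP p) hun) hy)
  have hrhs : rhsF p ∈ FP := by
    unfold rhsF
    exact append_mem_FP hx (append_mem_FP hz (comp_mem_FP L53Prog.glFn_mem_FP
      (fanoutFn_mem_FP (fanoutFn_mem_FP huk (comp_mem_FP onesFn_mem_FP hpad)) (fanoutFn_mem_FP hpad hz))))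
  unfold verF
  exact andFn_mem_FP (comp_mem_FP eqPairFn_mem_FP (fanoutFn_mem_FP (fanoutFn_mem_FP hw hui) fstF_mem_FP))
    (andFn_mem_FP (comp_mem_FP eqPairFn_mem_FP (fanoutFn_mem_FP hui (comp_mem_FP idx4UF_mem_FP
      (fanoutFn_mem_FP hun (fanoutFn_mem_FP huk (fanoutFn_mem_FP hut hus))))))
    (andFn_mem_FP (comp_mem_FP (lenLeFn_mem_FP X) (fanoutFn_mem_FP hw hun))
    (andFn_mem_FP (comp_mem_FP eqPairFn_mem_FP (fanoutFn_mem_FP hw hrhs))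
    (andFn_mem_FP (comp_mem_FP eqPairFn_mem_FP (fanoutFn_mem_FP (comp_mem_FP onesFn_mem_FP hz)
      (comp_mem_FP umulFn_mem_FP (fanoutFn_mem_FP (comp_mem_FP (polyFn_mem_FP (p + 1)) hun) huk))))
    (andFn_mem_FP (comp_mem_FP (lenLeFn_mem_FP p) (fanoutFn_mem_FP hx hy))
    (andFn_mem_FP (comp_mem_FP hr (fanoutFn_mem_FP hx hy))
    (andFn_mem_FP (comp_mem_FP (lenLeFn_mem_FP X) (fanoutFn_mem_FP hus hprog))
      (comp_mem_FP eqPairFn_mem_FP (fanoutFn_mem_FP (comp_mem_FP (runU_mem_FP U) (fanoutFn_mem_FP hprog hut))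
        (comp_mem_FP (cons_mem_FP true) hx))))))))))

end UPNP

open UPNP

/-! ### `L' ∈ NP` -/

/-- The certificate is polynomially short. [folklore] -/
theorem length_upCert_le (p : Polynomial ℕ) {n k t s : ℕ} {y z prog : List Bool} {v' : List Bool} {ι : ℕ}
    (hι : ι = idx4 n k t s) (hy : y.length ≤ p.eval n) (hz : z.length = (p.eval n + 1) * k) (hprog : prog.length ≤ s) :
    (upCert n k t s y z prog).length ≤
      ((2 * p + 2) * X + 2 * p + 12 * X + 16 : Polynomial ℕ).eval (paramEnc (v', ι)).length := by
  obtain ⟨hn, hk, ht, hs⟩ : n ≤ ι ∧ k ≤ ι ∧ t ≤ ι ∧ s ≤ ι := by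
    have := unidx4_le ι
    rw [hι, unidx4_idx4] at this
    simpa [hι] using this
  have hlen : ι ≤ (paramEnc (v', ι)).length := by
    simp only [paramEnc, length_boolPair, OracleCompose.unaryEncodeNat_eq_replicate, List.length_replicate]
    omega
  set L := (paramEnc (v', ι)).length
  have hp : p.eval n ≤ p.eval L := polynomial_eval_mono p (hn.trans hlen)
  have hzL : z.length ≤ (p.eval L + 1) * L := by rw [hz]; exact Nat.mul_le_mul (by omega) (hk.trans hlen)
  simp only [upCert, length_boolPair, eval_add, eval_mul, eval_X, eval_ofNat, ones, List.length_replicate]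
  nlinarith

namespace UniversalMachine

variable (U : UniversalMachine)

/-- **`L' ∈ NP`** for a verifier `(R, p)` with `R ∈ P`: certificate `⟨1ⁿ, 1ᵏ, 1ᵗ, 1ˢ, y, z, prog⟩`,
verifier `verF`. [Hirahara 2021 (ECCC TR21-058), proof of Thm. 8.9 ("It is easy to see that
`L' ∈ NP`")] [cite: Hirahara2021, Thm. 8.9 (proof)] -/
theorem upLang_mem_NP {R : Language Bool} (hR : R ∈ P) (p : Polynomial ℕ) : U.upLang R p ∈ NP := by
  -- the membership test of `R`
  obtain ⟨r, Mach, hMach⟩ := polyTimeDecidable_iff.1 (mem_P_iff_holds.1 hR)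
  have hdec : (fun z : List Bool => encodeBool (R.boolIndicator z)) ∈ FP := ⟨r, Mach, fun z => hMach z⟩
  set rTest : List Bool → List Bool := fun z => encodeBool (R.boolIndicator z) with hrT
  have hr : ∀ v, rTest v = [R.boolIndicator v] := fun v => rfl
  -- the verifier relation
  set R' : Language Bool := {π | verF p U rTest π = [true]} with hR'
  have hone : OneBit (verF p U rTest) := oneBit_verF fun z => ⟨_, rfl⟩
  have hR'P : R' ∈ Classes.P := by
    refine mem_P_of_mem_FP (verF_mem_FP hdec) R' fun w => ⟨fun hw => hw, fun hw => ?_⟩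
    obtain ⟨b, hb⟩ := hone w
    cases b with
    | true => exact absurd hb hw
    | false => exact hb
  refine ⟨R', hR'P, (2 * p + 2) * X + 2 * p + 12 * X + 16, fun v => ⟨fun hv => ?_, fun hv => ?_⟩⟩
  · -- completeness: `v ∈ L'` has a certificate
    obtain ⟨n, k, t, s, v', rfl, x, y, z, rfl, hx, hK, hy, hz⟩ := hv
    -- a short program printing `x` within `t` steps
    obtain ⟨prog, hrun, hplen⟩ := U.exists_run_eq_of_ktAt_lt (m := s + 1)
      (lt_of_le_of_lt hK (by exact_mod_cast Nat.lt_succ_self s))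
    have hplen' : prog.length ≤ s := by
      have : (prog.length : ℕ∞) < (s + 1 : ℕ) := by exact_mod_cast hplen
      exact Nat.lt_succ_iff.1 (by exact_mod_cast this)
    have hyn : y.length ≤ p.eval n := by rw [← hx]; exact hy.1
    refine ⟨upCert n k t s y z prog, length_upCert_le p rfl hyn hz hplen', ?_⟩
    change verF p U rTest (boolPair (paramEnc (_, idx4 n k t s)) (upCert n k t s y z prog)) = [true]
    rw [verF_apply hr]
    have htake : (x ++ dpGen k (padCert (p.eval n) y) z).take n = x := List.take_left' hx
    have hlen : ∀ m, (ones m).length = m := fun m => by simp [ones]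
    have e0 : nthF 0 (upCert n k t s y z prog) = ones n := by simp [upCert]
    have e1 : nthF 1 (upCert n k t s y z prog) = ones k := by simp [upCert]
    have e2 : nthF 2 (upCert n k t s y z prog) = ones t := by simp [upCert]
    have e3 : nthF 3 (upCert n k t s y z prog) = ones s := by simp [upCert]
    have e4 : nthF 4 (upCert n k t s y z prog) = y := by simp [upCert]
    have e5 : nthF 5 (upCert n k t s y z prog) = z := by simp [upCert]
    have e6 : sndPow 5 (upCert n k t s y z prog) = prog := by simp [upCert]
    rw [e0, e1, e2, e3, e4, e5, e6, hlen, hlen, hlen, hlen, htake]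
    exact ⟨rfl, by rw [List.length_append, hx]; omega, rfl, hz, hy.1, hy.2, hplen', hrun⟩
  · -- soundness: a certificate forces `v ∈ L'`
    obtain ⟨c, -, hc⟩ := hv
    have hc0 : verF p U rTest (boolPair v c) = [true] := hc
    have hv' := eq_paramEnc_of_verF v c hc0
    rw [hv'] at hc0 ⊢
    rw [verF_apply hr] at hc0
    obtain ⟨hι, hn, hw, hz, hylen, hyR, hplen, hrun⟩ := hc0
    set v' := fstF v
    set n := (nthF 0 c).length
    refine ⟨_, _, _, _, v', by rw [hι], ?_⟩
    refine ⟨v'.take n, nthF 4 c, nthF 5 c, hw, List.length_take_of_le hn, ?_, ⟨hylen, hyR⟩, hz⟩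
    exact (U.ktAt_le_length hrun).trans (by exact_mod_cast hplen)

end UniversalMachine

end Literature.Computability.MetaComplexity
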